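import Summits.ResolutionOfSingularities.ResolutionOfSingularities.Theorems.FrobeniusLadderFInjectiveMacaulayficationCoactionReesAwayRange
import HarnessLib

/-!
# The Rees–Veronese interface of a Laurent coaction, packaged (crux `FInjectiveMacaulayfication`, H-G2 abstract, IV)

Support file for crux stmt-ResolutionOfSingularities-15315 (`FrobeniusLadder.FInjectiveMacaulayfication`,
registered skeleton v11 `86e9127b`, line `graded-engine`, §16 G4 `stub_gradedChartClause`). [OURS · L1 W4.5a]

`reesInterface` assembles the abstract helper files (`LaurentCoaction`, `CoactionRees`, `CoactionReesAway`,
`CoactionReesAwayRange`) into exactly the hypothesis bundle of the G4 assembly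
`GradedChartClauseAssembly.chartClause_of_reesInterface` (stub-2, p481897), for an abstract commutative `k`-algebra
`L` with a Laurent coaction `β` (counit `hε`, homogeneous components `hΔ`, `k` in degree `0`), generated by
homogeneous elements, a homogeneous unit `U` of degree `N > 0`, and a subalgebra `C₀ ⊆ L` which is exactly the
non-negative part (`β z ∈ L[X]`): a Veronese subalgebra `A' ⊆ L[X]` over which `L[X]` is integral, with an
`A'`-linear retraction and `X^N ∈ A'`; a commutative ring `T` with `ι : C₀ ≃+* T`; a ring isomorphism
`e : T[Y][1/Y] ≃+* A'`; and the compatibility `e⁻¹(X^N) ∈ (ι u₀)` for any `u₀ ∈ C₀` lying over `U`.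

DESIGN. The bundle is delivered in continuation-passing style (`∀ P, (∀ A' … T [CommRing T] ι e, … → P) → P`) with
`T` a bound TYPE carrying its `CommRing` instance as a binder: the consumer quantifies over `(T₀ : Type) [CommRing T₀]`
and types `Localization.Away (X : T₀[X])` through that instance, so handing it a subalgebra `↥T₀` typed through the
synthesised `Subalgebra.toSemiring` forces a definitional comparison of the two ring structures which, over the
concrete weighted-blow-up rings, does not finish within millions of heartbeats. Here `T := ↥T₀` (the degree-`0`
subalgebra) is introduced with the instance `Subalgebra.toCommRing T₀` on both sides, so every later instantiation is
syntactic. Folklore; no definitions, no named facts.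
-/

-- single-problem summit: the doubled namespace component is forced
set_option linter.dupNamespace false

noncomputable section

open scoped LaurentPolynomial Polynomial
open AddMonoidAlgebra LaurentPolynomial
open Summit.ResolutionOfSingularities.ResolutionOfSingularities.Theorems.FInjectiveMacaulayfication
open Summit.ResolutionOfSingularities.ResolutionOfSingularities.Theorems.FInjectiveMacaulayfication.LaurentCoaction
open Summit.ResolutionOfSingularities.ResolutionOfSingularities.Theorems.FInjectiveMacaulayfication.CoactionRees

namespace Summit.ResolutionOfSingularities.ResolutionOfSingularities.Theorems.FInjectiveMacaulayfication.ReesInterface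

/-- **THE REES–VERONESE INTERFACE** (helper H-G2, abstract and packaged; see the module docstring for the shape and
the reason for the continuation-passing formulation). [folklore] -/
theorem reesInterface {k L : Type} [Field k] [CommRing L] [Algebra k L] (β : L →+* L[T;T⁻¹])
    (hε : ∀ ℓ : L, LaurentPolynomial.eval₂ (RingHom.id L) 1 (β ℓ) = ℓ)
    (hΔ : ∀ (ℓ : L) (i : ℤ), β ((β ℓ).coeff i) = single i ((β ℓ).coeff i))
    (hk : ∀ c : k, β (algebraMap k L c) = LaurentPolynomial.C (algebraMap k L c))
    (N : ℕ) (hN : 0 < N) (U V : L) (hUV : U * V = 1) (hU : β U = single (N : ℤ) U)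
    (G : Set L) (hG : ∀ g ∈ G, ∃ d : ℤ, β g = single d g) (hgen : Algebra.adjoin k G = ⊤)
    {R : Type} [CommRing R] [Algebra R L] (C₀ : Subalgebra R L)
    (hC₀ : ∀ z : L, z ∈ C₀ ↔ ∃ q : L[X], Polynomial.toLaurent q = β z) (u₀ : C₀) (hu₀ : (u₀ : L) = U)
    (P : Prop)
    (hP : ∀ (A' : Subalgebra k L[X]) [Algebra.IsIntegral A' L[X]] (ρ : L[X] →ₗ[A'] A'),
      (∀ x : A', ρ (x : L[X]) = x) → ∀ (hsN : (Polynomial.X : L[X]) ^ N ∈ A')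
      (T : Type) [CommRing T] (ι : C₀ ≃+* T) (e : Localization.Away (Polynomial.X : Polynomial T) ≃+* A'),
      e.symm ⟨Polynomial.X ^ N, hsN⟩ ∈ Ideal.span {algebraMap (Polynomial T)
        (Localization.Away (Polynomial.X : Polynomial T)) (Polynomial.C (ι u₀))} → P) : P := by
  classical
  have hV : β V = single (-(N : ℤ)) V := hom_of_mul_eq_one hUV hU
  -- the degree-`0` subalgebra `T₀` and the Veronese subalgebra `A'`
  obtain ⟨T₀, hT₀0⟩ := exists_subalgebra_of_coaction (k := k) β (Nat.castAddMonoidHom ℤ) (fun c => hk c)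
  have hT₀ : ∀ q : L[X], q ∈ T₀ ↔ ∀ m : ℕ, β (q.coeff m) = single (m : ℤ) (q.coeff m) := hT₀0
  obtain ⟨A', hA'0⟩ := exists_subalgebra_of_coaction (k := k)
    ((mapDomainRingHom L (Int.castAddHom (ZMod N))).comp β) (Nat.castAddMonoidHom (ZMod N))
    (mapDomain_algebraMap β _ hk)
  have hA' : ∀ q : L[X], q ∈ A' ↔ ∀ m : ℕ,
      (mapDomainRingHom L (Int.castAddHom (ZMod N))).comp β (q.coeff m) = single (m : ZMod N) (q.coeff m) := hA'0
  -- retraction, `X^N ∈ A'`, `C V ∈ A'`, integrality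
  obtain ⟨ρ, hρ⟩ := exists_retraction ((mapDomainRingHom L (Int.castAddHom (ZMod N))).comp β)
    (Nat.castAddMonoidHom (ZMod N)) (coassoc_mapDomain β _ hΔ) A' hA'0
  have hsN : (Polynomial.X : L[X]) ^ N ∈ A' := X_pow_mem_veronese β N A' hA'
  have hCV : Polynomial.C V ∈ A' := C_mem_veronese β N A' hA' hV (dvd_neg.mpr (dvd_refl _))
  haveI : Algebra.IsIntegral A' L[X] := isIntegral_veronese β N A' hA' hN G hG hgen
  -- `ι : C₀ ≃+* T₀` (homogenisation) and `ι u₀ = C U · X^N`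
  obtain ⟨ι, hι⟩ := CoactionReesAway.exists_iota β hε hΔ T₀ hT₀ C₀ hC₀
  have hιu : ((ι u₀ : T₀) : L[X]) = Polynomial.C U * Polynomial.X ^ N :=
    CoactionReesAway.eq_C_mul_X_pow_of_toLaurent _ U N (by rw [hι, hu₀, hU])
  -- `e : (↥T₀)[Y][1/Y] ≃+* A'`, through the abstract-model lemma with `T := ↥T₀`, `j := T₀.val`
  have hj : Function.Injective (T₀.val.toRingHom : ↥T₀ →+* L[X]) := fun a b h => Subtype.ext h
  have hTr : ∀ q : L[X], q ∈ Set.range (T₀.val.toRingHom : ↥T₀ →+* L[X]) ↔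
      ∀ m : ℕ, β (q.coeff m) = single (m : ℤ) (q.coeff m) := by
    intro q
    rw [← hT₀ q]
    constructor
    · rintro ⟨t, rfl⟩
      exact t.2
    · intro hq
      exact ⟨⟨q, hq⟩, rfl⟩
  obtain ⟨e, heC, -⟩ := CoactionReesAwayRange.exists_awayEquiv_of_range β hε hΔ N ↥T₀
    (T₀.val.toRingHom : ↥T₀ →+* L[X]) hj A' hTr hA' hN U V hUV hU
  refine hP A' ρ hρ hsN ↥T₀ ι e ?_
  -- the compatibility: `X^N = C V · (ι u₀)` in `A'`, and `e (C t) = t`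
  have hVU : V * U = 1 := by rw [mul_comm]; exact hUV
  have h1 : (⟨Polynomial.X ^ N, hsN⟩ : ↥A') = ⟨_, hCV⟩ *
      e (algebraMap (Polynomial ↥T₀) (Localization.Away (Polynomial.X : Polynomial ↥T₀)) (Polynomial.C (ι u₀))) :=
    Subtype.ext (by
      rw [Subalgebra.coe_mul, heC]
      show Polynomial.X ^ N = Polynomial.C V * ((ι u₀ : T₀) : L[X])
      rw [hιu, ← mul_assoc, ← map_mul, hVU, map_one, one_mul])
  rw [Ideal.mem_span_singleton']
  exact ⟨e.symm ⟨_, hCV⟩, by rw [h1, RingEquiv.map_mul, RingEquiv.symm_apply_apply]⟩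

end Summit.ResolutionOfSingularities.ResolutionOfSingularities.Theorems.FInjectiveMacaulayfication.ReesInterface

end
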